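import Literature.MathematicalPhysics.QuantumFieldTheory.Balaban1983to89.B15Ineq180PinAtRecord
import Literature.MathematicalPhysics.QuantumFieldTheory.Balaban1983to89.T3DescentFibreTower

/-!
# `Balaban1983to89.B15Claim189UnitTestAtRecord` — YM-DAG node N12 · [Balaban1989LargeFieldI] CMP **122** (1989) 175–202, (1.89) p. 198 with (1.20)–(1.24)
# pp. 180–182, [III] (2.11)–(2.12) p. 256, [I] (0.4) p. 253: THE (1.89) DISPLAY TESTED AT THE UNIT CONFIGURATION — the block averages OF RECORD of the unit
# configuration are the unit configuration (`M^j(1) = 1` for Bałaban's `exp[mean log]` averaging), so EVERY background of record built from unit data on ANY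
# determining set with ANY splice — `U^{(n)}_{k,Z}(1)`, `U″_{k,Z}(1)` — is FLAT; hence the deleted function `χ″_k` of (1.89) ((1.24) at `j = k`,
# r11's `chi124std`) and the «immediate» `χ_h(Ω_h∩Z_h)` HOLD at `V ≡ 1` for def-R's objects of record (positive thresholds): the consequent of the displayed
# (1.89) is true at `(1, B′)`, and with modules 7–8 both [IV] displays (1.80), (1.89) of a pinned layer are TESTED at `(1, 0)` — antecedent and consequent
# hold; neither vacuous nor refuted there

statement-level bookkeeping over published theorems with citation tags; kernel-checked compositions of tree theorems; nothing here is a claim about the Yang–Mills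
mass gap.

CITATION HEADER (lean-in-tree rule).  Source: [Balaban1989LargeFieldI] («[IV]»): (1.89) p. 198, (1.20)–(1.21) pp. 180–181 (*"U^{(n)}_{k,Z} = U(𝔹_k^{(n)}(Z),
(M˙(Q_k^{s*}V_k)↾_{Z∩Ω_k}, V↾_{Z∩Ω^c_k}))"*, *"U^{(N)}_{k,Z} = U″_{k,Z}"*), (1.24) pp. 181–182, (1.26) p. 182; [Balaban1988Convergent] («[III]») (2.11)–(2.12) p. 256;
[Balaban1987RG1] («[I]») (0.4) p. 253 (the averaging `exp[mean log]`).  Seat `pub-ymgap-dag-n12-e` (YM-PLAN Track A, HUMAN RULING D-0062; director-ym R134 row N12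
s3), module 9 (generation 3).  BY NAME and UNCHANGED: the tree's `T3DescentFibreTower.avgFun_one` ∕ `expMeanLogSU_E_one` (`Ū = 1` for `U = 1` under the printed
averaging — the 3D programme's lemma, generic in the lattice), def-R's `Node00.DatumAvLayer.avOfRecord` (`= blockAvg expMeanLogSU`), `Node00.SmallFieldChiOfRecord`
(`bgOfRecord`, `UminOfRecord`, `isMinimizer_UminOfRecord`), r12's `B15DeterminingSets` (`IsMinimizer`, `avgFamily`, `AgreeOn`, `splice`, `spliceAt`), r11's
`B15Sect1Instances` (`bgNZstd`, `bgPPZstd`, `vZstd`, `chi124std_iff`), r11's `B15Eq13Concrete.chi13`, r11's `B15Claim189AtInstances` (`chiPP_iff`, `chiH_iff`) through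
module 4's `chiPP_D189OfRecord_iff` ∕ `chiH_D189OfRecord_iff`, module 7 (`qsstarGIter0_one`, `wilsonAction4_unit`, `plaqHol_eq_one_of_wilsonAction4_eq_zero`,
`one_mem_plaqSmall`, `chi217_bgOfRecord_one`, `new189_D189OfRecord_one_iff`, `Sit189.pinChi182`, `chiP_pinChi182_zero`, `deltaPrimeOfRecord_pos_of_inInterval`), module 8
(`Sit189.pinDev0`, `ResidW.pinD189χ₀`, `ineq180_pinDev0_one`), module 5 (`epsOfRecord₁₀_pos_of_admissible`).

WHY THIS FILE.  Modules 7–8 tested the ANTECEDENT `new189` of the (1.80)∕(1.89) displays and the CONSEQUENT of (1.80) at the unit configuration; the consequent of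
(1.89) — r11's concrete `χ″_k = χ_k^{(k−h)}` at `U″_{k,Z}(V)` — was left, because `U″_{k,Z}` is the (2.12) solution for SPLICED data `(M˙(Q_k^{s*}V_k)↾, V↾)` on
the multi-scale determining set `𝔹_k^{(n)}(Z)`, and at `V ≡ 1` the splice mixes `M˙(1)` with `1`.  The one missing fact is that Bałaban's averaging of record maps
the unit configuration to the unit configuration; the 3D programme proved exactly this for the printed `exp[mean log]` average (`T3DescentFibreTower.avgFun_one`,
generic in the lattice), and def-R's `avOfRecord` IS that average (`rfl`).  With `M˙(1) = 1` every datum built from unit data agrees with `M˙(1)` on every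
determining set, so `1` is a minimiser, def-R's chosen solution has zero action and (on `SU(N)`) is flat — for `U^{(n)}_{k,Z}(1)` and `U″_{k,Z}(1)` alike
(their averages `V_Z^{(j)}(1)` of (1.26) are averages of a flat configuration; not needed here).  Then each line of (1.24) reads `0 <` (a positive threshold) and `χ″_k = 1`; the «immediate» `χ_h(Ω_h∩Z_h) = 1` is module 7's (2.17) lemma at
level `h`.

WHAT THIS FILE PROVES (0 `sorry`; no definition).
§1 `iter_avOfRecord_one`, `avgFamily_avOfRecord_one` (`M^j(1) = 1`, `M˙(1) = 1` for the averaging of record).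
§2 (generic `P`, `G`; flatness on `SU(N)`) `isMinimizer_one_of_agreeOn`, `wilsonAction4_eq_zero_of_isMinimizer_of_agreeOn`, `wilsonAction4_UminOfRecord_of_agreeOn`,
   `plaqHol_UminOfRecord_of_agreeOn`, `plaqSmallOn_UminOfRecord_of_agreeOn`.
§3 at the record's averaging: `agreeOn_avOfRecord_splice_one`, **`plaqSmallOn_bgNZstd_one`** (`U^{(n)}_{k,Z}(1)` flat, every `n`), `plaqSmallOn_bgPPZstd_one` (`U″_{k,Z}(1)`),
   `plaqHol_bgNZstd_one`, `E124_pos`, **`chi124std_bgOfRecord_one`** ((1.24) at `j = k` holds at `V ≡ 1`), **`chiPP_D189OfRecord_one`**, `chiH_D189OfRecord_one`,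
   **`claim189_tested_at_one`** (antecedent ↔ χ′, consequent TRUE at `(1, B′)`), `chiPP_D189OfRecord_one_of_admissible`.
§4 at the trebly-lettered pin of modules 7–8 (`ResidW.pinD189χ₀`): **`displays_tested_at_one_of_admissible`** — in the window at admissible `θ` (`A₁ > 0`), for a situation
   with `σ.h ≤ σ.k ≤ n`, `0 ≤ β < 1`, `0 < L₀`, `0 ≤ O(1)B₃B₅M⁵`: `new189 … (1,0)` ∧ (1.80)'s body at `(1,0)` ∧ `chiPP … (1,0)`.

HONEST FRAMING.  Count-neutral: kernel bookkeeping (unit data is a trivial point of every variational problem of record) by name; NO estimate of Bałaban's asserted,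
(1.24)∕(1.80)∕(1.89) NOT proved for any non-trivial configuration; N12 NOT discharged; one finite four-torus programme at fixed `ε`, Bałaban AS PRINTED with locators;
nothing continuum ∕ ℝ⁴ ∕ OS ∕ mass gap ∕ Clay.  No `sorry`, no `axiom`, no `instance`, no `notation`.
-/

noncomputable section

open scoped BigOperators
open MeasureTheory

namespace Literature.MathematicalPhysics.QuantumFieldTheory.Balaban1983to89

namespace B15Claim189UnitTestAtRecord

open DagBinding T4Continuum Node00
open B15DeterminingSets (MSField DetBackground DetSet IsMinimizer avgFamily AgreeOn splice spliceAt bondsOf pts)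
open B15Sect1Instances (bgNZstd bgPPZstd vZstd chi124std)
open B15Claim189Assembly (Setting189 new189 chiPP chiH dom)
open B15Claim189PinAtRecord (D189OfRecord chiPP_D189OfRecord_iff chiH_D189OfRecord_iff)
open B15Claim189PinNonVacuity (qsstarGIter0_one wilsonAction4_unit plaqHol_eq_one_of_wilsonAction4_eq_zero one_mem_plaqSmall chi217_bgOfRecord_one
  new189_D189OfRecord_one_iff)
open B15Chi124DetSets (E124)
open B15.PrelimIntegrations (cTop)
open B15 (Ineq180)
open B8Eq17ClassAkV1 (plaqsOf)
open BalabanImbrieJaffe1984to88.BIJ85Eq453GaugeField (qsstarGIter0)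
open GaugeGroup (dist1)
open GaugeField (plaqHol)

/-! ## §1. The averaging OF RECORD maps the unit configuration to the unit configuration -/

section Averaging

variable (F : T4Family) (N : ℕ) [NeZero N]

/-- **`M^j(1) = 1` FOR THE AVERAGING OF RECORD**: def-R's `avOfRecord` is Bałaban's block averaging with the printed `exp[mean log]` on `SU(N)` (`rfl`), whose value on
the unit configuration is the unit configuration at every level (the 3D programme's `T3DescentFibreTower.avgFun_one` with `expMeanLogSU_E_one`, generic in the lattice).
[cite: Balaban1987RG1, (0.4) p.253, (0.11) p.253; Balaban1988Convergent, (2.11) p.256] -/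
theorem iter_avOfRecord_one (K : ℕ) : ∀ j : ℕ, Averaging.iter (avOfRecord F N K) j (1 : GaugeField (F.P K) 0 (SU N)) = 1
  | 0 => rfl
  | j + 1 => by
    show (avOfRecord F N K j).avg (Averaging.iter (avOfRecord F N K) j 1) = 1
    rw [iter_avOfRecord_one K j, avOfRecord_avg]
    exact T3DescentFibreTower.avgFun_one _ T3DescentFibreTower.expMeanLogSU_E_one

/-- **`M˙(1) = 1`**: the multi-scale family of averages ([III] (2.11)) of the unit configuration is the unit multi-scale field. [cite: Balaban1988Convergent, (2.11) p.256] -/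
theorem avgFamily_avOfRecord_one (K : ℕ) : avgFamily (avOfRecord F N K) (1 : GaugeField (F.P K) 0 (SU N)) = 1 :=
  funext fun j => iter_avOfRecord_one F N K j

end Averaging

/-! ## §2. (generic) A datum that agrees with `M˙(1)` on its determining set has `1` as a minimiser; def-R's chosen solution is then flat -/

section Agree

variable {P : Params} {G : Type*} [GaugeGroup G] (av : ∀ j, Averaging P j G) {reg : Set (GaugeField P 0 G)}

/-- `1` minimises (2.12) for every datum `W` agreeing with `M˙(1)` on `𝐁` (in a regularity class containing `1`). [cite: Balaban1988Convergent, (2.12) p.256] -/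
theorem isMinimizer_one_of_agreeOn (h1 : (1 : GaugeField P 0 G) ∈ reg) {𝔹 : DetSet P} {W : MSField P G} (hW : AgreeOn 𝔹 (avgFamily av 1) W) :
    IsMinimizer av reg 𝔹 W 1 := by
  refine ⟨h1, hW, fun U _ _ => ?_⟩
  rw [wilsonAction4_unit]
  exact wilsonAction4_nonneg U

/-- … so every minimiser for such a datum has zero action. [cite: Balaban1988Convergent, (2.12) p.256] -/
theorem wilsonAction4_eq_zero_of_isMinimizer_of_agreeOn (h1 : (1 : GaugeField P 0 G) ∈ reg) {𝔹 : DetSet P} {W : MSField P G} (hW : AgreeOn 𝔹 (avgFamily av 1) W)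
    {U₀ : GaugeField P 0 G} (hU : IsMinimizer av reg 𝔹 W U₀) : wilsonAction4 U₀ = 0 := by
  have hle : wilsonAction4 U₀ ≤ wilsonAction4 (1 : GaugeField P 0 G) := hU.2.2 1 h1 hW
  rw [wilsonAction4_unit] at hle
  exact le_antisymm hle (wilsonAction4_nonneg _)

/-- … in particular def-R's chosen solution `UminOfRecord`. [cite: Balaban1988Convergent, (2.12) p.256] -/
theorem wilsonAction4_UminOfRecord_of_agreeOn [MeasurableSpace G] (h1 : (1 : GaugeField P 0 G) ∈ reg) {𝔹 : DetSet P} {W : MSField P G}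
    (hW : AgreeOn 𝔹 (avgFamily av 1) W) : wilsonAction4 (UminOfRecord av reg 𝔹 W) = 0 :=
  -- v1.1 (K0c g3 one-off, REBALANCE №62 S4): ONE instance binder `[MeasurableSpace G]` — the signature def-R's `UminOfRecord` carries under FILE 1 v2′ (director-ym №128 D1 (B)).
  wilsonAction4_eq_zero_of_isMinimizer_of_agreeOn av h1 hW (isMinimizer_UminOfRecord av reg ⟨1, isMinimizer_one_of_agreeOn av h1 hW⟩)

/-- `SU(N)`: def-R's chosen solution for a datum agreeing with `M˙(1)` is FLAT. [cite: Balaban1988Convergent, (2.12) p.256] -/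
theorem plaqHol_UminOfRecord_of_agreeOn {N : ℕ} [NeZero N] (av : ∀ j, Averaging P j (SU N)) {reg : Set (GaugeField P 0 (SU N))}
    (h1 : (1 : GaugeField P 0 (SU N)) ∈ reg) {𝔹 : DetSet P} {W : MSField P (SU N)} (hW : AgreeOn 𝔹 (avgFamily av 1) W) (p : Plaq P 0) :
    plaqHol (UminOfRecord av reg 𝔹 W) p = 1 :=
  plaqHol_eq_one_of_wilsonAction4_eq_zero _ (wilsonAction4_UminOfRecord_of_agreeOn av h1 hW) p

/-- … and satisfies every positive small-plaquette condition. [cite: Balaban1988Convergent, (1.4) p.247, (2.12) p.256] -/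
theorem plaqSmallOn_UminOfRecord_of_agreeOn {N : ℕ} [NeZero N] (av : ∀ j, Averaging P j (SU N)) {reg : Set (GaugeField P 0 (SU N))}
    (h1 : (1 : GaugeField P 0 (SU N)) ∈ reg) {𝔹 : DetSet P} {W : MSField P (SU N)} (hW : AgreeOn 𝔹 (avgFamily av 1) W) (S : Set (Plaq P 0)) {δ : ℝ}
    (hδ : 0 < δ) : PlaqSmallOn S δ (UminOfRecord av reg 𝔹 W) := by
  intro p _
  rw [plaqHol_UminOfRecord_of_agreeOn av h1 hW p, GaugeGroup.dist1_one]
  exact hδ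

end Agree

/-! ## §3. At the record: `U^{(n)}_{k,Z}(1)`, `U″_{k,Z}(1)` flat, (1.24) and `χ″_k` at `V ≡ 1` -/

section Backgrounds

variable {F : T4Family} {N : ℕ} [NeZero N] {K : ℕ}

/-- The (1.20) datum at `V ≡ 1` — `(M˙(Q_k^{s*}1)↾_{Z∩Ω_k}, 1↾)` — agrees with `M˙(1)` on EVERY determining set (both are the unit field bond by bond: `Q_k^{s*}1 = 1`,
`M˙(1) = 1`). [cite: Balaban1989LargeFieldI, (1.20) p.180; Balaban1988Convergent, (2.11) p.256] -/
theorem agreeOn_avOfRecord_splice_one (𝔹 : DetSet (F.P K)) (X : Set (Site (F.P K) 0)) (k : ℕ) :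
    AgreeOn 𝔹 (avgFamily (avOfRecord F N K) 1) (splice X (avgFamily (avOfRecord F N K) (qsstarGIter0 k (1 : GaugeField (F.P K) k (SU N)))) 1) := by
  intro j b _
  rw [qsstarGIter0_one, avgFamily_avOfRecord_one]
  show (1 : MSField (F.P K) (SU N)) j b = spliceAt (pts j X) ((1 : MSField (F.P K) (SU N)) j) ((1 : MSField (F.P K) (SU N)) j) b
  unfold spliceAt
  split_ifs <;> rfl

variable (reg : Set (GaugeField (F.P K) 0 (SU N))) (M₁ : ℕ) (Ω Zpp : ℕ → Set (Site (F.P K) 0)) (Z : Set (Site (F.P K) 0)) (h k : ℕ)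

/-- **`U^{(n)}_{k,Z}(1)` OF RECORD IS FLAT** (every `n`): it satisfies every positive small-plaquette condition (`1` regular). [cite: Balaban1989LargeFieldI, (1.20) p.180; Balaban1988Convergent, (2.12) p.256] -/
theorem plaqSmallOn_bgNZstd_one (h1 : (1 : GaugeField (F.P K) 0 (SU N)) ∈ reg) (n : ℕ) (S : Set (Plaq (F.P K) 0)) {δ : ℝ} (hδ : 0 < δ) :
    PlaqSmallOn S δ (bgNZstd (bgOfRecord (avOfRecord F N K) reg) M₁ Ω Zpp Z h k n (1 : MSField (F.P K) (SU N))) := by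
  rw [B15Sect1Instances.bgNZstd_apply, bgOfRecord_U]
  exact plaqSmallOn_UminOfRecord_of_agreeOn _ h1 (agreeOn_avOfRecord_splice_one _ _ k) S hδ

/-- **`U″_{k,Z}(1)` OF RECORD IS FLAT** ((1.21): `n = k − h`). [cite: Balaban1989LargeFieldI, (1.21) p.181] -/
theorem plaqSmallOn_bgPPZstd_one (h1 : (1 : GaugeField (F.P K) 0 (SU N)) ∈ reg) (S : Set (Plaq (F.P K) 0)) {δ : ℝ} (hδ : 0 < δ) :
    PlaqSmallOn S δ (bgPPZstd (bgOfRecord (avOfRecord F N K) reg) M₁ Ω Zpp Z h k (1 : MSField (F.P K) (SU N))) := by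
  rw [B15Sect1Instances.bgPPZstd_eq]
  exact plaqSmallOn_bgNZstd_one reg M₁ Ω Zpp Z h k h1 _ S hδ

/-- Every plaquette variable of `U^{(n)}_{k,Z}(1)` of record is `1`. [cite: Balaban1989LargeFieldI, (1.20) p.180 (bookkeeping)] -/
theorem plaqHol_bgNZstd_one (h1 : (1 : GaugeField (F.P K) 0 (SU N)) ∈ reg) (n : ℕ) (p : Plaq (F.P K) 0) :
    plaqHol (bgNZstd (bgOfRecord (avOfRecord F N K) reg) M₁ Ω Zpp Z h k n (1 : MSField (F.P K) (SU N))) p = 1 := by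
  rw [B15Sect1Instances.bgNZstd_apply, bgOfRecord_U]
  exact plaqHol_UminOfRecord_of_agreeOn _ h1 (agreeOn_avOfRecord_splice_one _ _ k) p

/-- `E_{k,i} = ε_i(L^{k−i}η)² > 0` for positive `ε_i`, `L`, `η`. [cite: Balaban1989LargeFieldI, (1.24) p.182 (bookkeeping)] -/
theorem E124_pos {ε : ℕ → ℝ} {L η : ℝ} {k i : ℕ} (hε : 0 < ε i) (hL : 0 < L) (hη : 0 < η) : 0 < E124 ε L η k i := by
  unfold E124
  exact mul_pos hε (pow_pos (mul_pos (pow_pos hL _) hη) 2)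

/-- **(1.24) AT `j = k` HOLDS AT `V ≡ 1` for def-R's objects of record**: every line is a small-plaquette condition on the flat `U″_{k,Z}(1)` with a POSITIVE threshold —
`0 ≤ β < 1` (print: `0 < β ≤ 1/2`, p. 182; (1.89) assumes `β ≤ 1/4`), `0 < L₀`, `0 < ε_i` for `h ≤ i ≤ k`, `1` regular, `h ≤ k`. [cite: Balaban1989LargeFieldI, (1.24) pp.181–182, (1.21) p.181] -/
theorem chi124std_bgOfRecord_one (h1 : (1 : GaugeField (F.P K) 0 (SU N)) ∈ reg) (hhk : h ≤ k) (k₀ : ℕ) {β L₀ : ℝ} (hβ0 : 0 ≤ β) (hβ1 : β < 1) (hL₀ : 0 < L₀)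
    {ε : ℕ → ℝ} (hε : ∀ i, h ≤ i → i ≤ k → 0 < ε i) :
    chi124std (bgOfRecord (avOfRecord F N K) reg) M₁ Ω Zpp Z h k k₀ (k - h) β L₀ ε ((F.P K).L : ℝ) ((F.P K).eta k) (1 : MSField (F.P K) (SU N)) := by
  have hL : 0 < ((F.P K).L : ℝ) := (F.P K).cast_L_pos
  have hη : 0 < (F.P K).eta k := pow_pos (inv_pos.mpr hL) k
  have hk : h + (k - h) = k := by omega
  have hL₀2 : 0 < L₀ ^ 2 := pow_pos hL₀ 2
  have hhalf : ∀ m : ℕ, 0 < 1 - β * (1 - (1 / 2 : ℝ) ^ m) := fun m => by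
    have hx : 0 ≤ (1 / 2 : ℝ) ^ m := pow_nonneg (by norm_num) m
    have hx1 : (1 / 2 : ℝ) ^ m ≤ 1 := pow_le_one₀ (by norm_num) (by norm_num)
    nlinarith
  have hb2 : 0 < 1 - β / 2 := by linarith
  rw [B15Sect1Instances.chi124std_iff]
  refine ⟨fun i hi hik => ?_, ?_, fun l _ hl => ?_, ?_⟩
  · exact plaqSmallOn_bgNZstd_one reg M₁ Ω Zpp Z h k h1 _ _
      (mul_pos (mul_pos (hhalf _) (pow_pos hL₀2 _)) (E124_pos (hε i hi (by omega)) hL hη))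
  · rw [hk]
    exact plaqSmallOn_bgNZstd_one reg M₁ Ω Zpp Z h k h1 _ _ (mul_pos (mul_pos hb2 (pow_pos hL₀2 _)) (E124_pos (hε k hhk le_rfl) hL hη))
  · rw [hk]
    exact plaqSmallOn_bgNZstd_one reg M₁ Ω Zpp Z h k h1 _ _ (mul_pos (mul_pos hb2 (pow_pos hL₀ _)) (E124_pos (hε k hhk le_rfl) hL hη))
  · rw [hk]
    have hc : 0 < cTop k k := by unfold cTop; split_ifs <;> norm_num
    exact plaqSmallOn_bgNZstd_one reg M₁ Ω Zpp Z h k h1 _ _ (mul_pos (mul_pos hc hb2) (E124_pos (hε k hhk le_rfl) hL hη))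

end Backgrounds

section AtRecord

variable {F : T4Family} {N : ℕ} [NeZero N] (θ : Stage9Params F N) (P : B12.RunParams) (σ : Sit189 F N P.K)

/-- **THE CONSEQUENT OF (1.89) AT THE UNIT CONFIGURATION**: r11's concrete `χ″_k = χ_k^{(k−h)}` ((1.24) at `j = k`) HOLDS at `U″_{k,Z}(1)` of record — `chiPP (D189OfRecord θ P σ)
(1, B′)` — for `σ.h ≤ σ.k`, `εreg > 0`, `0 < ε_i` (`σ.h ≤ i ≤ σ.k`), `0 ≤ σ.β < 1`, `0 < σ.L₀` (module 4's `chiPP_D189OfRecord_iff` by name). [cite: Balaban1989LargeFieldI, (1.89) p.198, (1.24) p.182, (1.21) p.181] -/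
theorem chiPP_D189OfRecord_one (hhk : σ.h ≤ σ.k) (hreg : 0 < θ.ν.εreg) (hε : ∀ i, σ.h ≤ i → i ≤ σ.k → 0 < epsOfRecord θ.ν (gOfRecord₁₀ F N θ P) i)
    (hβ0 : 0 ≤ σ.β) (hβ1 : σ.β < 1) (hL₀ : 0 < σ.L₀) (B' : (j : ℕ) → VecField (F.P P.K) j σ.𝔤) :
    chiPP (D189OfRecord θ P σ) ((1 : MSField (F.P P.K) (SU N)), B') := by
  rw [chiPP_D189OfRecord_iff θ P σ hhk]
  exact chi124std_bgOfRecord_one _ θ.ν.M₁ σ.Ω σ.Zpp σ.Z σ.h σ.k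
    (one_mem_plaqSmall (mul_pos hreg (pow_pos (pow_pos (inv_pos.mpr (F.P P.K).cast_L_pos) σ.k) 2))) hhk σ.k₀ hβ0 hβ1 hL₀ hε

/-- **THE «IMMEDIATE» DELETED FUNCTION `χ_h(Ω_h∩Z_h)` AT THE UNIT CONFIGURATION**: r11's concrete (1.3) function at level `h` is `1` at `V ≡ 1` (module 7's (2.17) lemma
at level `h`; `σ.h ≤ σ.k`, `εreg > 0`, `ε_h > 0`). [cite: Balaban1989LargeFieldI, (1.89) p.198 («The equality χ_h(Ω_h∩Z_h) = 1 is immediate»), (1.3) p.178] -/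
theorem chiH_D189OfRecord_one (hhk : σ.h ≤ σ.k) (hreg : 0 < θ.ν.εreg) (hεh : 0 < epsOfRecord θ.ν (gOfRecord₁₀ F N θ P) σ.h)
    (B' : (j : ℕ) → VecField (F.P P.K) j σ.𝔤) : chiH (D189OfRecord θ P σ) ((1 : MSField (F.P P.K) (SU N)), B') := by
  rw [chiH_D189OfRecord_iff θ P σ hhk]
  exact chi217_bgOfRecord_one _ (one_mem_plaqSmall (mul_pos hreg (pow_pos (pow_pos (inv_pos.mpr (F.P P.K).cast_L_pos) σ.k) 2))) _ _ _ _ hεh σ.h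

/-- **THE (1.89) DISPLAY TESTED AT THE UNIT CONFIGURATION**: at `U = (1, B′)` the antecedent `new189` holds iff `χ′(B′)` (module 7) and the consequent `χ″_k` holds
outright — so the displayed implication `Claim189 (new189 ·) (chiPP ·)` is TRUE at every `(1, B′)` and, where `χ′(B′)` holds, true with a TRUE antecedent (tested, not
vacuous, not refuted).  Hypotheses: `σ.h ≤ σ.k`, `εreg > 0`, `0 < ε_i` on `[σ.h, σ.k]`, `0 ≤ σ.β < 1`, `0 < σ.L₀`. [cite: Balaban1989LargeFieldI, (1.89) p.198 (bookkeeping witness)] -/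
theorem claim189_tested_at_one (hhk : σ.h ≤ σ.k) (hreg : 0 < θ.ν.εreg) (hε : ∀ i, σ.h ≤ i → i ≤ σ.k → 0 < epsOfRecord θ.ν (gOfRecord₁₀ F N θ P) i)
    (hβ0 : 0 ≤ σ.β) (hβ1 : σ.β < 1) (hL₀ : 0 < σ.L₀) (B' : (j : ℕ) → VecField (F.P P.K) j σ.𝔤) :
    (new189 (D189OfRecord θ P σ) ((1 : MSField (F.P P.K) (SU N)), B') ↔ σ.chiP B') ∧ chiPP (D189OfRecord θ P σ) ((1 : MSField (F.P P.K) (SU N)), B') :=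
  ⟨new189_D189OfRecord_one_iff θ P σ hhk hreg (hε σ.k hhk le_rfl) (hε σ.h le_rfl hhk) B', chiPP_D189OfRecord_one θ P σ hhk hreg hε hβ0 hβ1 hL₀ B'⟩

variable {θ} in
/-- The consequent at `V ≡ 1` with the sign inputs READ OFF ADMISSIBILITY AND THE WINDOW (`εreg`, `ε_i` for `i ≤ n`; module 5), for a situation with `σ.h ≤ σ.k ≤ n`.
[cite: Balaban1989LargeFieldI, (1.89) p.198; Balaban1988Convergent, (2.4) p.255, (2.12) p.256] -/
theorem chiPP_D189OfRecord_one_of_admissible (hθ : θ.Admissible) (hγ1 : θ.γ < 1) {n : ℕ} (hI : Step.InInterval θ.γ n (gOfRecord₁₀ F N θ P))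
    (hhk : σ.h ≤ σ.k) (hkn : σ.k ≤ n) (hβ0 : 0 ≤ σ.β) (hβ1 : σ.β < 1) (hL₀ : 0 < σ.L₀) (B' : (j : ℕ) → VecField (F.P P.K) j σ.𝔤) :
    chiPP (D189OfRecord θ P σ) ((1 : MSField (F.P P.K) (SU N)), B') :=
  chiPP_D189OfRecord_one θ P σ hhk hθ.1.1.2.2.1
    (fun i _ hik => B15Claim189FlowAtRecord.epsOfRecord₁₀_pos_of_admissible hθ hγ1 P hI i (hik.trans hkn)) hβ0 hβ1 hL₀ B'

end AtRecord

/-! ## §4. At the trebly-lettered pin of modules 7–8: both [IV] displays tested at `(1, 0)` in the window -/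

section Layer

variable {F : T4Family} {N : ℕ} [NeZero N] (lam : ResidW F N) {θ : Stage9Params F N} (σ : ∀ P : B12.RunParams, Sit189 F N P.K) (p₁ : ℕ)

/-- **BOTH [IV] DISPLAYS OF A PINNED LAYER TESTED AT THE UNIT CONFIGURATION** (`λ.pinD189χ₀ θ σ p₁`: χ′ := print's (1.82) instance with `δ′_k` of record, `dev0 :=
|U_{k,Z}(V_Λ)(∂q) − 1|` of record): in the window `]0, γ]` (`γ < 1`) at admissible `θ` with `A₁ > 0`, for a run `P` and a situation with `σ.h ≤ σ.k ≤ n`, `0 ≤ β < 1`,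
`0 < L₀`, `0 ≤ O(1)B₃B₅M⁵`, at `U = (1, 0)`: the common antecedent `new189` HOLDS (module 7), the body of the (1.80) display HOLDS (module 8), and the consequent `χ″_k`
of the (1.89) display HOLDS (§3).  Kernel census: the displays are contentful and consistent at the unit configuration; nothing of Bałaban's is thereby proved.
[cite: Balaban1989LargeFieldI, (1.80) p.195, (1.89) p.198, (1.82) p.196, (1.24) p.182] -/
theorem displays_tested_at_one_of_admissible (hθ : θ.Admissible) (hγ1 : θ.γ < 1) (hA₁ : 0 < θ.A₁) (P : B12.RunParams) {n : ℕ}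
    (hI : Step.InInterval θ.γ n (gOfRecord₁₀ F N θ P)) (hhk : (σ P).h ≤ (σ P).k) (hkn : (σ P).k ≤ n) (hβ0 : 0 ≤ (σ P).β) (hβ1 : (σ P).β < 1)
    (hL₀ : 0 < (σ P).L₀) (hB : 0 ≤ (σ P).O1 * (σ P).B₃ * (σ P).B₅ * (σ P).M ^ 5) :
    new189 ((lam.pinD189χ₀ θ σ p₁).D189 P) ((1 : MSField (F.P P.K) (SU N)), fun _ _ => (0 : EuclideanSpace ℝ (Fin (N ^ 2 - 1)))) ∧
    (∀ i, ((lam.pinD189χ₀ θ σ p₁).D189 P).h ≤ i → i ≤ ((lam.pinD189χ₀ θ σ p₁).D189 P).k → ∀ q ∈ plaqsOf (dom ((lam.pinD189χ₀ θ σ p₁).D189 P) i),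
      Ineq180 (((lam.pinD189χ₀ θ σ p₁).D189 P).dev0 ((1 : MSField (F.P P.K) (SU N)), fun _ _ => (0 : EuclideanSpace ℝ (Fin (N ^ 2 - 1)))) q)
        (((lam.pinD189χ₀ θ σ p₁).D189 P).ε ((lam.pinD189χ₀ θ σ p₁).D189 P).k) ((lam.pinD189χ₀ θ σ p₁).D189 P).η ((lam.pinD189χ₀ θ σ p₁).D189 P).B₃
        ((lam.pinD189χ₀ θ σ p₁).D189 P).B₅ ((lam.pinD189χ₀ θ σ p₁).D189 P).M ((lam.pinD189χ₀ θ σ p₁).D189 P).δ (((lam.pinD189χ₀ θ σ p₁).D189 P).dist q)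
        ((lam.pinD189χ₀ θ σ p₁).D189 P).O1) ∧
    chiPP ((lam.pinD189χ₀ θ σ p₁).D189 P) ((1 : MSField (F.P P.K) (SU N)), fun _ _ => (0 : EuclideanSpace ℝ (Fin (N ^ 2 - 1)))) := by
  obtain ⟨hnew, h180⟩ := B15Ineq180PinAtRecord.h180_pinD189χ₀_one_of_admissible lam σ p₁ hθ hγ1 hA₁ P hI hhk hkn hB
  refine ⟨hnew, h180, ?_⟩
  exact chiPP_D189OfRecord_one_of_admissible P
    (((σ P).pinChi182 (B15Claim189PinNonVacuity.deltaPrimeOfRecord F N θ P p₁ (σ P).k)).pinDev0 θ.ν) hθ hγ1 hI hhk hkn hβ0 hβ1 hL₀ _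

end Layer

end B15Claim189UnitTestAtRecord

end Literature.MathematicalPhysics.QuantumFieldTheory.Balaban1983to89

end
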